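import Summits.ResolutionOfSingularities.ResolutionOfSingularities.Theorems.HilbertSamuelEliminationSigmaMaxModificationsCorridor3WLadderSegmentsDefs
import HarnessLib

/-!
# [OURS · L1 W4.2] SEGMENT EXTRACTION («U-seg»), ASSEMBLY in model (b): `Wlow3CharM` from `KeyTheorem640_char_localized_isolated`
# (crux `SigmaMaxModifications` stmt-ResolutionOfSingularities-18506; conjunct `SigmaMaxModificationsCorridor3` stmt-…-19249; line `w_ladder` v6;
# plan-1 RULINGS v3.10-1 (A): «the variant assembly `wlow3CharM_assembledLocQ … ` next to p502345's `wlow3CharM_assembledQ`»)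

Stub worker res-L1-w42-stub-1 (gen 3). Proof-only companion of `…Corridor3WLadderSegmentsDefs` (`Moving.UnitTowerExtractionLocAtQM`,
`Moving.UnitTowerExtractionLocQM`). PROVED reductions, verbatim twins of `wlow3CharUnitsM_of_extractionQ` / `wlow3CharM_assembledQ`
(`…Corridor3WLadderMovingIsoLowQ`, p502345) with the admissible F-key of model (b), `KeyTheorem640_char_localized_isolated`
(`KeyTheoremsLocal.lean`, F-04c), in place of `KeyTheorem640_char_isolated`:

* `Moving.wlow3CharUnitsM_of_extractionLocQ` — UNITS-half of `Wlow3CharM` from the F-key + the third-door socket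
  `IsoLowDirDimTerminatesQM` + the model-(b) extraction `UnitTowerExtractionLocQM`;
* `Moving.wlow3CharM_assembledLocQ : KeyTheorem640_char_localized_isolated → IsoLowDirDimTerminatesQM p → UnitTowerExtractionLocQM p →
  Wlow3CharStrataM p → Wlow3CharM p`;
* `Moving.unitTowerExtractionLocQM_of_atQM` — instantiation of the regime-free row at any `Q` implying nothing (monotonicity in `Q`).

OURS; NOT statements of the manuscript [Hironaka2017] nor of [CossartJannsenSaito2020]. AI-written; AI review is weaker than expert review.

References: V. Cossart, U. Jannsen, S. Saito, LNM 2270 (2020), Thm. 6.35, Cor. 6.37, Def. 6.39, Thm. 6.40, p. 107 [CossartJannsenSaito2020].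
-/

noncomputable section

set_option linter.dupNamespace false -- mandated namespace of this single-conjunct summit

open CategoryTheory AlgebraicGeometry TopologicalSpace

namespace Summit.ResolutionOfSingularities.ResolutionOfSingularities.Theorems.SigmaMaxModificationsCorridor3.Moving

open Literature.AlgebraicGeometry.Resolution Literature.RingTheory.HilbertSamuel
open Literature.AlgebraicGeometry.CossartJannsenSaito2020
open Summit.ResolutionOfSingularities.ResolutionOfSingularities.Theorems.CampaignW42
open Summit.ResolutionOfSingularities.ResolutionOfSingularities.Theorems.SigmaMaxModificationsCorridor3.Helpers

/-- The regime-free extraction row is antitone in the origin predicate. [folklore] -/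
theorem UnitTowerExtractionLocAtQM.mono {p : ℕ} {Q Q' : ℕ → (ℕ → ℕ) → ∀ X : Scheme.{0}, X → Prop}
    (h : UnitTowerExtractionLocAtQM p Q) (hQQ' : ∀ N ν (X : Scheme.{0}) (x : X), Q' N ν X x → Q N ν X x) :
    UnitTowerExtractionLocAtQM p Q' :=
  fun R hRf hRa ν X _ x hX hQ' c h0 hstep hG hmov hrec he => h R hRf hRa ν X x hX (hQQ' _ _ _ _ hQ') c h0 hstep hG hmov hrec he

/-- The all-origins extraction gives the (F1)-regime instance. [folklore] -/
theorem unitTowerExtractionLocQM_of_atQM_true {p : ℕ} (h : UnitTowerExtractionLocAtQM p fun _ _ _ _ => True) :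
    UnitTowerExtractionLocQM p :=
  h.mono fun _ _ _ _ _ => trivial

/-- **PROVED REDUCTION, model (b): the UNITS-half of `Wlow3CharM`** from the admissible F-key `KeyTheorem640_char_localized_isolated`
(F-04c) + the third-door socket `IsoLowDirDimTerminatesQM` + the unit-wise localised extraction `UnitTowerExtractionLocQM` — the proof of
`wlow3CharUnitsM_of_extractionQ` verbatim with the model-(b) key. [cite: CossartJannsenSaito2020, Thm. 6.40, Cor. 6.37, p. 107] -/
theorem wlow3CharUnitsM_of_extractionLocQ {p : ℕ} (hK : KeyTheorem640_char_localized_isolated.{0})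
    (hlow : IsoLowDirDimTerminatesQM p) (hext : UnitTowerExtractionLocQM p) : Wlow3CharUnitsM p := by
  intro R hRf hRa ν X _ x hX hq
  rintro ⟨c, h0, hstep, hG, hmov, hrec⟩
  by_cases hlowstage : ∃ m, Iso 3 (c m) ∧ dirDim (c m) ≤ 1
  · obtain ⟨m, hiso, hdir⟩ := hlowstage
    exact hlow R hRf hRa ν X x hX hq (c m) (reaches_chain h0 hstep m) hiso hdir
      ⟨fun n => c (m + n), Relation.ReflTransGen.refl, fun n => hstep (m + n), fun n => hG (m + n), io_shift hmov m⟩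
  · push Not at hlowstage
    have he : ∀ n, Iso 3 (c n) → dirDim (c n) = 2 ∧ (c n).geomDirDim = 2 := by
      intro n hiso
      have h1 := hlowstage n hiso
      have h2 := dirDim_le_geomDirDim (c n)
      have h3 := hG n
      exact ⟨by omega, by omega⟩
    obtain ⟨T, len, pt, tpt, hchain, hset, hchar, hisoT⟩ := hext R hRf hRa ν X x hX hq c h0 hstep hG hmov hrec he
    exact hK T 3 len pt tpt hset hchar hchain hisoT

/-- **`Wlow3CharM` assembled in model (b) (PROVED reduction)**: `KeyTheorem640_char_localized_isolated` + `IsoLowDirDimTerminatesQM` +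
`UnitTowerExtractionLocQM` + `Wlow3CharStrataM`. [cite: CossartJannsenSaito2020, Thm. 6.40, Cor. 6.37, Thm. 6.35, p. 107] -/
theorem wlow3CharM_assembledLocQ {p : ℕ} (hK : KeyTheorem640_char_localized_isolated.{0}) (hlow : IsoLowDirDimTerminatesQM p)
    (hext : UnitTowerExtractionLocQM p) (hS : Wlow3CharStrataM p) : Wlow3CharM.{0} p :=
  wlow3CharM_of_units_strata (wlow3CharUnitsM_of_extractionLocQ hK hlow hext) hS

end Summit.ResolutionOfSingularities.ResolutionOfSingularities.Theorems.SigmaMaxModificationsCorridor3.Moving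

end
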